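import Summits.QuantumFields.QCD.Theses.HeatSlicedQuarks
import Summits.QuantumFields.QCD.Theses.GapBuysCauchyRate
import Summits.QuantumFields.QCD.Theorems.GapBuysCauchyRateConvergentOSClosureStubClosureOfLatticeInputs
import Summits.QuantumFields.QCD.Theorems.GapBuysCauchyRateCauchySummation
import Literature.MathematicalPhysics.QuantumFieldTheory.QCDCalibratedSpecies

/-!
# Crux `InterleavedFlowProper` (stmt-QuantumFields-18031), line `finite-range-heat-slices` — the package vocabulary
# of the line and its two soft stubs as theorems: the OS closure along the full sequence (`stub_osDataAlongFullSequence`)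
# and the one-line reduction of E1 to item 8840 (`rotationRestorationFR_of_rotationRestoration`)

Registered stubs of the gen-3 skeleton `Cruxes/InterleavedFlowProper/Lines/finite_range_heat_slices.lean` (namespace
`Summit.QuantumFields.QCD.Cruxes.InterleavedFlowProper.FiniteRangeHeatSlices`).  The line is a design for X₀ =
`ContinuumQCDExists` (the crux is ≡ X₀, p158714) with ONE threaded witness `(reg, 𝒞)`: the UV output of the flow is typed
in X₀'s own vocabulary (`FRFlowPackage reg 𝒞 M₀` over the honest lattice functionals `qcdLatticeSchwinger` / `qcdLatticeDist`
of the calibrated scheme `𝒞.scheme m`), the infrared residue is named (item 8796 = N_f = 0 lattice gap, item 8840 = rotation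
restoration, both BY NAME), and the soft OS closure is a theorem.

Contents.  §1 the lattice-level predicates `IsLimitFamily`, `IsRotationInvariant`, `HasUniformLinearGrowth`, `HasCauchyRate`,
`HasUniformDistBound` (T), `HasThermalComparison` (COMP), `HasTimeOrderedClustering` (CL), `KappaThreeWitness`, `CalibrationBites`; §2 the package
`FRFlowPackage`; §3 the two soft stub statements `RotationRestorationFR`, `OSClosureFR`; §4 the theorems
`rotationRestorationFR_of_rotationRestoration : Theses.GapBuysCauchyRate.RotationRestoration → RotationRestorationFR` and
`stub_osDataAlongFullSequence : OSClosureFR` — the latter from the landed soft OS closure toolkit of the sibling cruxes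
`StableActionBridge` (stmt-9737) and `ConvergentOSClosure` (stmt-11525): `HasCauchyRate` + `cauchySummation_proof` (11526) ⇒
convergence on off-diagonal real tensors; T + `stub_offDiagonalTensorDensity` ⇒ convergence on all of ⁰𝒮 and the Hahn–Banach
limit family with E0′ (`exists_labelled_tendsto`); E0 from `isNormalized_qcdLatticeDist`; translations from T
(`tendsto_qcdLatticeDist_translateMulti_sub`); E2 from T + COMP + physical branch + `β_k ≥ 0` eventually (`stub_rpOfComparison`,
resting on the Lüscher/Osterwalder–Seiler site-RP of the antiperiodic odd torus `stub_rpOfSymThermal`); hermiticity from E2 + E0;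
E3 from the exact lattice symmetry `stub_permExact`; E4 from CL; rotations by hypothesis; packaging and the three witnesses by
`stub_speciesPackaging` (calibration bites P4, κ₃ witness P5).  Why (T, COMP) and not finite-volume RP: `qcdLatticeSchwinger`
integrates time-PERIODIC Wilson quarks (the `(−1)^F`-twisted trace), which is NOT reflection positive at finite `k`
(`QCDTimeReflection`, `WilsonQCDSiteReflectionPositivityAP` docstring; MontvayMunster1994 §4.2.3 p.180 "RP has to be fulfilled
only in the continuum limit"); COMP is the boundary-condition insensitivity from which RP of the limit is a landed theorem.
References: OsterwalderSchrader1975 §2, §4; GlimmJaffeQP1987 §6.1, Thm 17.9.1; Luscher1977; MontvayMunster1994 §4.2.3.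
-/

noncomputable section

namespace Summit.QuantumFields.QCD.Cruxes.InterleavedFlowProper.FiniteRangeHeatSlices

open scoped BigOperators Matrix ComplexOrder SchwartzMap
open Filter Topology
open Literature.MathematicalPhysics.QuantumFieldTheory Literature.MathematicalPhysics.QuantumLattice
  Literature.MathematicalPhysics.AQFT
open Summit.QuantumFields.QCD.Theses.HeatSlicedQuarks
open Summit.QuantumFields.QCD.Cruxes.StableActionBridge.Sketch (qcdLatticeDist qcdLatticeDistSymAP)

/-! ## §1 Lattice-level predicates in X₀'s own vocabulary (`qcdLatticeSchwinger` / `qcdLatticeDist` of ONE threaded scheme) -/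

variable {Nf : ℕ}

/-- `S` is the `k → ∞` limit, along the FULL sequence, of the honest lattice QCD `n`-point functions of `sch`
on off-diagonal real tensors (exactly the convergence clause of `IsQCDAlong`, with the limit family explicit). -/
def IsLimitFamily (sch : QCDScheme Nf)
    (S : LabelledSchwingerFamily (QCDField Nf) (EuclideanSpace ℝ (Fin 4))) : Prop :=
  ∀ n : ℕ, n ≠ 0 → ∀ (σ : Fin n → QCDField Nf) (f : Fin n → 𝓢(EuclideanSpace ℝ (Fin 4), ℝ))
    (F : 𝓢((Fin n → EuclideanSpace ℝ (Fin 4)), ℂ)),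
    IsTensorOf F (fun i => ofRealTest (f i)) → IsOffDiagonal F →
      Tendsto (fun k : ℕ => qcdLatticeSchwinger sch k n σ f) atTop (𝓝 (S n σ F))

/-- Invariance of a labelled family under proper rotations on ⁰𝒮 (the rotation half of E1; conclusion shape of
item 8840 `RotationRestoration`). -/
def IsRotationInvariant (S : LabelledSchwingerFamily (QCDField Nf) (EuclideanSpace ℝ (Fin 4))) : Prop :=
  ∀ (n : ℕ) (σ : Fin n → QCDField Nf) (Rot : EuclideanSpace ℝ (Fin 4) ≃ₗᵢ[ℝ] EuclideanSpace ℝ (Fin 4)),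
    LinearMap.det (Rot.toLinearEquiv : EuclideanSpace ℝ (Fin 4) →ₗ[ℝ] EuclideanSpace ℝ (Fin 4)) = 1 →
      ∀ F : 𝓢((Fin n → EuclideanSpace ℝ (Fin 4)), ℂ), IsOffDiagonal F → S n σ (linActMulti Rot F) = S n σ F

/-- **`HasUniformDistBound` — (T), k-UNIFORM LINEAR GROWTH on ⁰𝒮 (lattice E0′)**: ONE `(s, α, β)`, `α ≥ 0`, such that,
eventually in `k` (threshold depending on `(n, σ)` only), EVERY off-diagonal test function `F ∈ ⁰𝒮ₙ` obeys
`‖S_k(F)‖ ≤ α (n!)^β |F|_{ns}` for the canonical lattice `n`-point DISTRIBUTIONS `qcdLatticeDist sch k` (continuous linear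
functionals on `𝓢`, equal to `qcdLatticeSchwinger` on real tensors, `qcdLatticeSchwinger_eq_qcdLatticeDist`) — Glimm–Jaffe's
uniform bound (Thm 17.9.1), the format in which a convergent single-norm flow outputs its correlation bounds (large fields inside
the norm), and the E0′/extension/translation input of the soft OS closure (gen 3: replaces the gen-1 tensor-only clause
`HasUniformLinearGrowth`, whose F-dependent threshold no inheritance lemma can consume — worker B6 D2).
[GlimmJaffeQP1987 Thm 17.9.1; OsterwalderSchrader1975 §2 (E0′)] -/
def HasUniformDistBound (sch : QCDScheme Nf) : Prop :=
  ∃ (s : ℕ) (α β : ℝ), 0 ≤ α ∧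
    ∀ (n : ℕ) (σ : Fin n → QCDField Nf), ∀ᶠ k in atTop,
      ∀ F : 𝓢((Fin n → EuclideanSpace ℝ (Fin 4)), ℂ), IsOffDiagonal F →
        ‖qcdLatticeDist sch k n σ F‖ ≤ α * (n.factorial : ℝ) ^ β * schwartzNorm (n * s) F

/-- **GEOMETRIC CAUCHY RATE along the full sequence**: `‖S_{k+1}(F) − S_k(F)‖ ≤ C(F) θᵏ` for one `θ < 1` — the
observable-level output of the finite-range flow's contractivity (two cutoffs = two initial conditions differing
by an irrelevant term; the difference contracts in the `K`-norm) ONCE the infrared clusters; consumed by the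
landed `CauchySummation` (11526) shape. -/
def HasCauchyRate (sch : QCDScheme Nf) : Prop :=
  ∃ θ : ℝ, 0 < θ ∧ θ < 1 ∧ ∀ n : ℕ, n ≠ 0 → ∀ (σ : Fin n → QCDField Nf)
    (f : Fin n → 𝓢(EuclideanSpace ℝ (Fin 4), ℝ)) (F : 𝓢((Fin n → EuclideanSpace ℝ (Fin 4)), ℂ)),
    IsTensorOf F (fun i => ofRealTest (f i)) → IsOffDiagonal F →
      ∃ C : ℝ, ∀ k : ℕ, ‖qcdLatticeSchwinger sch (k + 1) n σ f - qcdLatticeSchwinger sch k n σ f‖ ≤ C * θ ^ k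

/-- **`HasThermalComparison` — (COMP), the reflection-positivity input of the soft OS closure**: for some norm index `s`,
E0′-norm closeness, eventually in `k`, of the time-PERIODIC own-torus distributions `qcdLatticeDist sch k` to the Θ-symmetrised
thermal (antiperiodic) ones `qcdLatticeDistSymAP sch k` on ⁰𝒮 — the boundary-condition insensitivity (clustering in time at the
massive point, `e^{−M a_k L_k}`) from which reflection positivity of the limit is a landed theorem (`stub_rpOfComparison` ←
Lüscher/Osterwalder–Seiler site-RP of the antiperiodic odd torus), the `(−1)^F`-twisted trace of `qcdLatticeSchwinger` itself NOT
being RP at finite `k` (worker B6 D1; clause text of the repaired sibling crux R′ of stmt-11525, `convergentOSClosure_retyped`).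
[MontvayMunster1994 §4.2.3 p.180; OsterwalderSeiler1978 §§2–4; Luscher1977] -/
def HasThermalComparison (sch : QCDScheme Nf) : Prop :=
  ∃ s : ℕ, ∀ ε : ℝ, 0 < ε → ∀ (n : ℕ) (σ : Fin n → QCDField Nf), ∀ᶠ k in atTop,
    ∀ F : 𝓢((Fin n → EuclideanSpace ℝ (Fin 4)), ℂ), IsOffDiagonal F →
      ‖qcdLatticeDistSymAP sch k n σ F - qcdLatticeDist sch k n σ F‖ ≤ ε * schwartzNorm (n * s) F

/-- **`HasTimeOrderedClustering` — (CL), the E4 input of the soft OS closure** (verbatim clause of R′ of stmt-11525): k-uniform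
spatial clustering of `qcdLatticeDist sch k` on time-ordered test functions, in the ε–t₀ form the landed inheritance lemma
`hasClusterProperty_of_labelled_tendsto` consumes (general time-ordered `F, G`, append-tensor witnesses `H`, spatial `a`).
[OsterwalderSchrader1975 §2 (E4); GlimmJaffeQP1987 §6.1] -/
def HasTimeOrderedClustering (sch : QCDScheme Nf) : Prop :=
  ∀ (n n' : ℕ) (σ : Fin n → QCDField Nf) (σ' : Fin n' → QCDField Nf)
    (F : 𝓢((Fin n → EuclideanSpace ℝ (Fin 4)), ℂ)) (G : 𝓢((Fin n' → EuclideanSpace ℝ (Fin 4)), ℂ)),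
    IsTimeOrdered F → IsTimeOrdered G → ∀ a : EuclideanSpace ℝ (Fin 4), a 0 = 0 → a ≠ 0 →
    ∀ ε : ℝ, 0 < ε → ∃ t₀ : ℝ, ∀ t : ℝ, t₀ ≤ t →
      ∀ H : 𝓢((Fin (n + n') → EuclideanSpace ℝ (Fin 4)), ℂ),
        IsAppendTensorOf H (osAdjoint F) (translateMulti (t • a) G) →
        ∀ᶠ k in atTop, ‖qcdLatticeDist sch k (n + n') (Fin.append (σ ∘ Fin.rev) σ') H -
          qcdLatticeDist sch k n (σ ∘ Fin.rev) (osAdjoint F) * qcdLatticeDist sch k n' σ' G‖ ≤ ε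

/-- **The glue κ₃-witness** (verbatim shape of items 17307/11525): a connected THREE-point function of `glue` on a
time-separated triple stays bounded away from `0`, eventually in `k` — for `tr F²` the free Wick triangle VANISHES
(`maxwellRing3_eq_zero`), so this is the O(g²) one-loop term with its sign (Sketch-dead H3; triage r1-3 (α)), a
short-distance statement in the heavy corner (the scheme's `Λ` is free, so unit distance is ultraviolet). -/
def KappaThreeWitness (sch : QCDScheme Nf) : Prop :=
  ∃ f g h : 𝓢(EuclideanSpace ℝ (Fin 4), ℝ),
    tsupport (f : EuclideanSpace ℝ (Fin 4) → ℝ) ⊆ {x | x 0 < 0} ∧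
    tsupport (g : EuclideanSpace ℝ (Fin 4) → ℝ) ⊆ {x | 0 < x 0 ∧ x 0 < 1} ∧
    tsupport (h : EuclideanSpace ℝ (Fin 4) → ℝ) ⊆ {x | 1 < x 0} ∧
    ∃ ε > (0 : ℝ), ∀ᶠ k in atTop,
      ε ≤ ‖qcdLatticeSchwinger sch k 3 ![QCDField.glue, QCDField.glue, QCDField.glue] ![f, g, h]
          - qcdLatticeSchwinger sch k 1 ![QCDField.glue] ![f] *
              qcdLatticeSchwinger sch k 2 ![QCDField.glue, QCDField.glue] ![g, h]
          - qcdLatticeSchwinger sch k 1 ![QCDField.glue] ![g] *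
              qcdLatticeSchwinger sch k 2 ![QCDField.glue, QCDField.glue] ![f, h]
          - qcdLatticeSchwinger sch k 1 ![QCDField.glue] ![h] *
              qcdLatticeSchwinger sch k 2 ![QCDField.glue, QCDField.glue] ![f, g]
          + 2 * (qcdLatticeSchwinger sch k 1 ![QCDField.glue] ![f] *
              qcdLatticeSchwinger sch k 1 ![QCDField.glue] ![g] *
                qcdLatticeSchwinger sch k 1 ![QCDField.glue] ![h])‖

/-- **The calibration bites** for glue and for every flavour-changing pseudoscalar (verbatim shape of 17307): the
reference two-point function on `(Θf₀, f₀)` of the calibrated family equals `1` eventually — the wave-function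
renormalisation CONDITION fixing `z_s(m,k)`; with `HasUniformDistBound` it excludes both `z ≡ 0` and the
decoupled super-heavy witness (`m_crit ≡ +5`: normalising at `τ₀` blows up every shorter separation). -/
def CalibrationBites {reg : QCDRegularisation Nf} (𝒞 : CalibratedSpeciesFamily reg) (m : Fin Nf → ℝ) : Prop :=
  (∀ᶠ k in atTop, (𝒞.scheme m).twoPoint k QCDField.glue QCDField.glue (thetaTest 4 𝒞.f₀) 𝒞.f₀ = 1) ∧
    ∀ f g : Fin Nf, f ≠ g → ∀ᶠ k in atTop,
      (𝒞.scheme m).twoPoint k (QCDField.pseudoRe f g) (QCDField.pseudoRe f g) (thetaTest 4 𝒞.f₀) 𝒞.f₀ = 1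

/-- **The N_f = 0 lattice gap along every AF Wilson sequence — item stmt-QuantumFields-8796 VERBATIM**
(`Summit.QuantumFields.QCD.YMLatticeGapAlongAFSequences`, ∀-typed, another route's
item with its own seat; restated here symbol for symbol instead of imported because that route's Theses module is volatile
on the verification farm — the ledger deduplicates items by normalised signature): for all scaling data `(a_k → 0, a_k L_k → ∞)`
and EVERY coupling sequence with N_f = 0 two-loop asymptotic scaling, lattice SU(3) Yang–Mills (Wilson action, fundamental
representation) has a lattice gap `Δ′ > 0` in the units set by `a_k`, uniformly in the volume, for all gauge-invariant local
observables. [JaffeWitten2000; Balaban1988Convergent] -/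
def YMLatticeGapAlongAFSequences : Prop :=
  ∀ (a : ℕ → ℝ) (L : ℕ → ℕ), (∀ k, 0 < a k) → Filter.Tendsto a Filter.atTop (nhds 0) →
    Filter.Tendsto (fun k => a k * L k) Filter.atTop Filter.atTop → ∀ β' : ℕ → ℝ,
      (∃ Λ' : ℝ, 0 < Λ' ∧ Filter.Tendsto (fun k => β' k - afBeta 0 Λ' (a k)) Filter.atTop (nhds 0)) →
        ∃ Δ' : ℝ, 0 < Δ' ∧ ∀ A B : YMSpecies (Matrix.specialUnitaryGroup (Fin 3) ℂ), ∃ C : ℝ,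
          ∀ᶠ k in Filter.atTop, ∀ S : ℕ, L k ≤ S → ∀ n : ℕ, n ≤ S →
            |latticeConnectedCorr (fundamentalRep (Fin 3)) (β' k) (2 * S + 1) A.F B.F n| ≤
              C * Real.exp (-(Δ' * (a k * n)))

/-! ## §2 The UV package of the finite-range flow (gap-free clauses + the IR handover clause) -/

/-- **`FRFlowPackage reg 𝒞 M₀` — what the finite-range (V,K)-flow delivers for ONE mass-independent regularisation
`reg` and ONE calibrated species family `𝒞` in the heavy corner above the offset `M₀`** (R1/R2 of Sketch-dead: the
witness is a parameter, every clause is strictly weaker than X₀ and typed over the honest lattice functionals).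
UV block (unconditional): (P1) two-loop asymptotic scaling; for every tuple above `M₀`: (P2) physical branch `m_f(k) > −1`
eventually, (P3) `HasUniformDistBound` (T: k-uniform E0′ bound on ⁰𝒮), (P4) the calibration bites for glue and every
`pseudoRe f g`, (P5) the glue κ₃-witness.  IR block (P6), THE HANDOVER: IF the N_f = 0 lattice gap holds along every AF Wilson
sequence (item 8796 VERBATIM, `YMLatticeGapAlongAFSequences`) THEN every tuple above `M₀` has a
uniform lattice gap `HasLatticeMassGap Δ` (heavy-quark transfer at block scale `1/M₀`), the thermal comparison
`HasThermalComparison` (COMP) and the time-ordered spatial clustering `HasTimeOrderedClustering` (CL) — gen 3, replacing the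
consumer-less `HasFineClustering` after worker B6's finding —, and a geometric Cauchy rate along the FULL sequence (one-step
remainder of the contractive flow × clustering — the `UVStabilityNonUniqueness` evasion (e)).  The transfers need the flow's
effective action, so they live HERE and not in a ∀-scheme stub (for an arbitrary scheme `bounds ∧ clustering ⇒ convergence`
is FALSE: alternate two admissible `m_crit` sequences). -/
def FRFlowPackage (reg : QCDRegularisation Nf) (𝒞 : CalibratedSpeciesFamily reg) (M₀ : ℝ) : Prop :=
  (reg.scheme 0 0 0).HasAsymptoticScaling ∧
  (∀ m : Fin Nf → ℝ, (∀ f, M₀ < m f) →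
    (∀ fl : Fin Nf, ∀ᶠ k in atTop, -1 < (𝒞.scheme m).mq fl k) ∧
    HasUniformDistBound (𝒞.scheme m) ∧ CalibrationBites 𝒞 m ∧ KappaThreeWitness (𝒞.scheme m)) ∧
  (YMLatticeGapAlongAFSequences →
    ∀ m : Fin Nf → ℝ, (∀ f, M₀ < m f) →
      ∃ Δ : ℝ, 0 < Δ ∧ (𝒞.scheme m).HasLatticeMassGap Δ ∧
        HasThermalComparison (𝒞.scheme m) ∧ HasTimeOrderedClustering (𝒞.scheme m) ∧ HasCauchyRate (𝒞.scheme m))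

/-! ## §3 The two soft stub statements of the line -/

/-- **`RotationRestorationFR` — E1 for the line's own schemes** (item 8840 `RotationRestoration` restricted to
`N_f ∈ {2,3}` and to calibrated families carrying the package, so that the a²O₆ insertion control of the flow is
available to its prover; follows from 8840 by name in one line if that item closes, survives a junk-`N_f`
refutation of it): every full-sequence limit family of a gapped package scheme is invariant under proper rotations
on ⁰𝒮. [Symanzik1983; DKKMO2020Rotational; GlimmJaffeQP1987 Thm 17.9.1 caveat] -/
def RotationRestorationFR : Prop :=
  ∀ Nf : ℕ, Nf = 2 ∨ Nf = 3 → ∀ (reg : QCDRegularisation Nf) (𝒞 : CalibratedSpeciesFamily reg) (M₀ : ℝ),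
    FRFlowPackage reg 𝒞 M₀ → ∀ m : Fin Nf → ℝ, (∀ f, M₀ < m f) →
      (∃ Δ : ℝ, 0 < Δ ∧ (𝒞.scheme m).HasLatticeMassGap Δ) →
        ∀ S : LabelledSchwingerFamily (QCDField Nf) (EuclideanSpace ℝ (Fin 4)),
          IsLimitFamily (𝒞.scheme m) S → IsRotationInvariant S

/-- **`OSClosureFR` — OS data along the FULL sequence** (the soft closure, gen-3 typing after worker B6's recon): for a
package scheme above `M₀` (so with (T) `HasUniformDistBound`, (P4), (P5)), with the thermal comparison (COMP), the time-ordered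
clustering (CL), a geometric Cauchy rate, and rotation-invariant limits, there is ONE `T : OSData` whose Schwinger functions ARE
the full-sequence limits of the honest lattice `n`-point functions (Cauchy ⇒ limits on real tensors, `CauchySummation` 11526;
T ⇒ convergence on all of ⁰𝒮 and the Hahn–Banach limit family with E0′; E0 exact; translations from T; E2 from T + COMP +
physical branch + `β_k ≥ 0` eventually (`stub_rpOfComparison`); hermiticity from E2 + E0; E3 exact; E4 from CL; rotations by
hypothesis), with `IsNontrivial glue`, `IsNonGaussian glue` and `IsNontrivial (pseudoRe f g)` read off (P4)/(P5)
(`stub_speciesPackaging`).  (The gen-1/2 clauses `HasLatticeMassGap Δ` / `HasFineClustering Δ` are dropped here: E4 now comes from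
CL; the gap is consumed only by the rotation stub.) [OsterwalderSchrader1975 §2, §4; GlimmJaffeQP1987 §6.1, §17.9; Luscher1977;
MontvayMunster1994 §4.2.3] -/
def OSClosureFR : Prop :=
  ∀ Nf : ℕ, Nf = 2 ∨ Nf = 3 → ∀ (reg : QCDRegularisation Nf) (𝒞 : CalibratedSpeciesFamily reg) (M₀ : ℝ),
    FRFlowPackage reg 𝒞 M₀ → ∀ m : Fin Nf → ℝ, (∀ f, M₀ < m f) →
      HasThermalComparison (𝒞.scheme m) → HasTimeOrderedClustering (𝒞.scheme m) → HasCauchyRate (𝒞.scheme m) →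
        (∀ S : LabelledSchwingerFamily (QCDField Nf) (EuclideanSpace ℝ (Fin 4)),
          IsLimitFamily (𝒞.scheme m) S → IsRotationInvariant S) →
          ∃ T : OSData (QCDField Nf) 4, IsLimitFamily (𝒞.scheme m) T.schwinger ∧
            T.IsNontrivial QCDField.glue ∧ T.IsNonGaussian QCDField.glue ∧
              ∀ f g : Fin Nf, f ≠ g → T.IsNontrivial (QCDField.pseudoRe f g)

/-! ## §4 The theorems -/

/-- (P1) of the package read on `𝒞.scheme m`: the calibrated scheme has the same `a`, `β` as `reg.scheme 0 0 0`
(definitionally), so asymptotic scaling transports by `rfl`. -/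
theorem hasAsymptoticScaling_scheme {reg : QCDRegularisation Nf} (𝒞 : CalibratedSpeciesFamily reg)
    (m : Fin Nf → ℝ) (h : (reg.scheme 0 0 0).HasAsymptoticScaling) : (𝒞.scheme m).HasAsymptoticScaling := h

/-- **E1 of the line reduces to item 8840 in one line**: `RotationRestoration → RotationRestorationFR` (apply 8840 to the
calibrated scheme `𝒞.scheme m` with (P1) asymptotic scaling, (P2) the physical branch and the lattice gap). -/
theorem rotationRestorationFR_of_rotationRestoration
    (h : Theses.GapBuysCauchyRate.RotationRestoration) : RotationRestorationFR :=
  fun Nf _hNf _reg 𝒞 _M₀ hpkg m hm hgap S hS =>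
    h Nf (𝒞.scheme m) (hasAsymptoticScaling_scheme 𝒞 m hpkg.1) (hpkg.2.1 m hm).1 hgap S hS

/-- **Registered stub `stub_osDataAlongFullSequence` — the soft OS closure along the full sequence, PROVED** from the landed soft
OS closure toolkit of the sibling cruxes `StableActionBridge` (stmt-9737) and `ConvergentOSClosure` (stmt-11525):
`HasCauchyRate` + `cauchySummation_proof` ⇒ limits on off-diagonal real tensors; T + `stub_offDiagonalTensorDensity` ⇒
convergence on all of ⁰𝒮 and the Hahn–Banach limit family with E0′ (`exists_labelled_tendsto`); E0 (`isNormalized_qcdLatticeDist`);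
translations from T (`tendsto_qcdLatticeDist_translateMulti_sub`); E2 from T + COMP + branch + `β_k ≥ 0` (`stub_rpOfComparison`);
hermiticity from E2 + E0; E3 (`stub_permExact`); E4 from CL; rotations by hypothesis; packaging + witnesses (`stub_speciesPackaging`). -/
theorem stub_osDataAlongFullSequence : OSClosureFR := by
  intro Nf hNf reg 𝒞 M₀ hpkg m hm hCOMP hcl hcauchy hrot
  obtain ⟨has, hUV, -⟩ := hpkg
  obtain ⟨hbr, hT, ⟨h2g, h2q⟩, hκ⟩ := hUV m hm
  -- (T) at index `s₁` and (COMP) at index `s₂` both hold at `s := max s₁ s₂` (`schwartzNorm_mono`)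
  obtain ⟨s₁, α, β, hα, hb₁⟩ := hT
  obtain ⟨s₂, hcomp₂⟩ := hCOMP
  set s : ℕ := max s₁ s₂ with hs
  have hb : ∀ (n : ℕ) (σ : Fin n → QCDField Nf), ∀ᶠ k in atTop,
      ∀ F : 𝓢((Fin n → EuclideanSpace ℝ (Fin 4)), ℂ), IsOffDiagonal F →
        ‖qcdLatticeDist (𝒞.scheme m) k n σ F‖ ≤ α * (n.factorial : ℝ) ^ β * schwartzNorm (n * s) F := by
    intro n σ
    filter_upwards [hb₁ n σ] with k hk F hF
    exact (hk F hF).trans (mul_le_mul_of_nonneg_left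
      (schwartzNorm_mono (Nat.mul_le_mul_left n (le_max_left s₁ s₂)) F) (by positivity))
  have hcomp : ∀ ε : ℝ, 0 < ε → ∀ (n : ℕ) (σ : Fin n → QCDField Nf), ∀ᶠ k in atTop,
      ∀ F : 𝓢((Fin n → EuclideanSpace ℝ (Fin 4)), ℂ), IsOffDiagonal F →
        ‖qcdLatticeDistSymAP (𝒞.scheme m) k n σ F - qcdLatticeDist (𝒞.scheme m) k n σ F‖ ≤
          ε * schwartzNorm (n * s) F := by
    intro ε hε n σ
    filter_upwards [hcomp₂ ε hε n σ] with k hk F hF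
    exact (hk F hF).trans (mul_le_mul_of_nonneg_left
      (schwartzNorm_mono (Nat.mul_le_mul_left n (le_max_right s₁ s₂)) F) hε.le)
  have hNf16 : Nf ≤ 16 := by rcases hNf with rfl | rfl <;> norm_num
  -- (P1) of the package, read on `𝒞.scheme m` (same `a`, `β` as `reg.scheme 0 0 0`)
  have hAS : (𝒞.scheme m).HasAsymptoticScaling := has
  -- (0) convergence on off-diagonal real tensors: geometric Cauchy rate + `CauchySummation` (item 11526, landed)
  have hconv : ∀ n : ℕ, n ≠ 0 → ∀ (σ : Fin n → QCDField Nf) (f : Fin n → 𝓢(EuclideanSpace ℝ (Fin 4), ℝ))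
      (F : 𝓢((Fin n → EuclideanSpace ℝ (Fin 4)), ℂ)), IsTensorOf F (fun i => ofRealTest (f i)) →
      IsOffDiagonal F →
        ∃ c : ℂ, Tendsto (fun k : ℕ => qcdLatticeSchwinger (𝒞.scheme m) k n σ f) atTop (𝓝 c) := by
    obtain ⟨θ, hθ0, hθ1, hC⟩ := hcauchy
    intro n hn σ f F hF hoff
    obtain ⟨C, hCk⟩ := hC n hn σ f F hF hoff
    exact Summit.QuantumFields.QCD.Theorems.cauchySummation_proof _ (fun k => θ ^ k) C
      (summable_geometric_of_lt_one hθ0.le hθ1) hCk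
  -- (P6) asymptotic translation invariance on `⁰𝒮` from the E0′ bound T
  -- adapted from `ConvergentOSClosure.stub_closureOfLatticeInputs`
  have htr : ∀ (n : ℕ) (σ : Fin n → QCDField Nf) (a : EuclideanSpace ℝ (Fin 4))
      (F : 𝓢((Fin n → EuclideanSpace ℝ (Fin 4)), ℂ)), IsOffDiagonal F →
        Tendsto (fun k : ℕ => qcdLatticeDist (𝒞.scheme m) k n σ (translateMulti a F) -
          qcdLatticeDist (𝒞.scheme m) k n σ F) atTop (𝓝 0) := fun n σ a F hF =>
    Summit.QuantumFields.QCD.Theorems.ConvergentOSClosure.tendsto_qcdLatticeDist_translateMulti_sub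
      (𝒞.scheme m) σ (mul_nonneg hα (Real.rpow_nonneg (Nat.cast_nonneg _) β)) (n * s) (hb n σ) a F hF
  -- (P8) eventually approximately positive OS forms from T + COMP (`β_k ≥ 0` eventually, physical branch)
  have hrp := Summit.QuantumFields.QCD.Theorems.ConvergentOSClosure.stub_rpOfComparison Nf (𝒞.scheme m)
    (QCDScheme.eventually_le_beta_of_hasAsymptoticScaling hNf16 (𝒞.scheme m) hAS 0) hbr s α β hα hb hcomp
  -- adapted from `ConvergentOSClosure.stub_softClosure`, steps (1)–(4) (the gap step (5) is not needed here)
  -- (1) convergence on all of `⁰𝒮`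
  have hconv' : ∀ (n : ℕ) (σ : Fin n → QCDField Nf) (F : 𝓢((Fin n → EuclideanSpace ℝ (Fin 4)), ℂ)),
      IsOffDiagonal F → ∃ c : ℂ, Tendsto (fun k => qcdLatticeDist (𝒞.scheme m) k n σ F) atTop (𝓝 c) :=
    Summit.QuantumFields.QCD.Cruxes.StableActionBridge.Sketch.tendsto_qcdLatticeDist_of_tensor (𝒞.scheme m)
      Summit.QuantumFields.QCD.Cruxes.StableActionBridge.Sketch.stub_offDiagonalTensorDensity hb hconv
  -- (2) the limit family on `⁰𝒮`, with the E0′ bound everywhere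
  obtain ⟨S, hS, hSb⟩ :=
    Summit.QuantumFields.QCD.Cruxes.StableActionBridge.Sketch.exists_labelled_tendsto
      (fun k => qcdLatticeDist (𝒞.scheme m) k) (fun n => α * (n.factorial : ℝ) ^ β) (fun n => n * s)
      (fun n => by positivity) hb hconv'
  -- (3) the honest lattice `n`-point functions converge to `S` on off-diagonal real tensors
  have htensor : IsLimitFamily (𝒞.scheme m) S := by
    intro n hn σ f F hF hoff
    refine (hS n σ F hoff).congr' (Eventually.of_forall fun k => ?_)
    exact Summit.QuantumFields.QCD.Cruxes.StableActionBridge.Sketch.qcdLatticeSchwinger_eq_qcdLatticeDist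
      (𝒞.scheme m) k n hn σ f F hF
  -- (4) the axioms of `S`
  have h0 : S.IsNormalized :=
    Summit.QuantumFields.QCD.Cruxes.StableActionBridge.Sketch.isNormalized_of_labelled_tendsto hS
      (Eventually.of_forall fun k =>
        Summit.QuantumFields.QCD.Cruxes.StableActionBridge.Sketch.isNormalized_qcdLatticeDist (𝒞.scheme m) k)
  have hE0' : S.HasLinearGrowth :=
    Summit.QuantumFields.QCD.Cruxes.StableActionBridge.Sketch.hasLinearGrowth_of_labelled_bound S s α β
      fun n k F _ => hSb n k F
  have hE1t : ∀ (n : ℕ) (σ : Fin n → QCDField Nf) (a : EuclideanSpace ℝ (Fin 4))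
      (F : 𝓢((Fin n → EuclideanSpace ℝ (Fin 4)), ℂ)), IsOffDiagonal F →
      S n σ (translateMulti a F) = S n σ F :=
    Summit.QuantumFields.QCD.Cruxes.StableActionBridge.Sketch.translate_eq_of_labelled_tendsto hS htr
  have hE2 : S.IsReflectionPositive :=
    Summit.QuantumFields.QCD.Cruxes.StableActionBridge.Sketch.isReflectionPositive_of_labelled_tendsto hS hrp
  -- E0-hermiticity is a consequence of E2 and E0-normalisation (Kravchuk–Qiao–Rychkov Rem. 2.2)
  have h0' : S.IsHermitian :=
    Summit.QuantumFields.YangMills.Cruxes.ContinuumLimitOnTrajectory.TwoOrbitSynchronisation.osLegsC_isHermitian_of_isReflectionPositive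
      S hE2 h0
  -- E3 from the EXACT lattice symmetry `stub_permExact`
  have hsymm : ∀ (n : ℕ) (σ : Fin n → QCDField Nf) (π : Equiv.Perm (Fin n))
      (F : 𝓢((Fin n → EuclideanSpace ℝ (Fin 4)), ℂ)), IsOffDiagonal F →
      Tendsto (fun k => qcdLatticeDist (𝒞.scheme m) k n σ (permTest π F) -
        qcdLatticeDist (𝒞.scheme m) k n (σ ∘ π) F) atTop (𝓝 0) := by
    intro n σ π F _
    have hzero : (fun k => qcdLatticeDist (𝒞.scheme m) k n σ (permTest π F) -
        qcdLatticeDist (𝒞.scheme m) k n (σ ∘ π) F) = fun _ => 0 :=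
      funext fun k => by
        rw [Summit.QuantumFields.QCD.Cruxes.StableActionBridge.Sketch.stub_permExact, sub_self]
    rw [hzero]
    exact tendsto_const_nhds
  have hE3 : S.IsSymmetric :=
    Summit.QuantumFields.QCD.Cruxes.StableActionBridge.Sketch.isSymmetric_of_labelled_tendsto hS hsymm
  have hE4 : S.HasClusterProperty :=
    Summit.QuantumFields.QCD.Cruxes.StableActionBridge.Sketch.hasClusterProperty_of_labelled_tendsto hS hcl
  -- E1 (rotations) by hypothesis, for THIS limit family
  have hRot : ∀ (n : ℕ) (σ : Fin n → QCDField Nf)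
      (Rot : EuclideanSpace ℝ (Fin 4) ≃ₗᵢ[ℝ] EuclideanSpace ℝ (Fin 4)),
      LinearMap.det (Rot.toLinearEquiv : EuclideanSpace ℝ (Fin 4) →ₗ[ℝ] EuclideanSpace ℝ (Fin 4)) = 1 →
      ∀ F : 𝓢((Fin n → EuclideanSpace ℝ (Fin 4)), ℂ), IsOffDiagonal F →
        S n σ (linActMulti Rot F) = S n σ F := hrot S htensor
  -- (5) packaging + the three witnesses (calibration bites P4, κ₃ witness P5)
  obtain ⟨T, hTS, hN, hG, hP⟩ :=
    Summit.QuantumFields.QCD.Theorems.ConvergentOSClosure.stub_speciesPackaging Nf reg 𝒞 m h2g h2q hκ S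
      ⟨⟨h0, h0', ⟨hE1t, hRot⟩, hE2, hE3, hE4⟩, hE0'⟩ htensor
  refine ⟨T, ?_, hN, hG, hP⟩
  rw [hTS]
  exact htensor



end Summit.QuantumFields.QCD.Cruxes.InterleavedFlowProper.FiniteRangeHeatSlices

end
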